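import Summits.CriticalPhenomena.PercolationContinuityZ3.Theorems.FreeBoxPowerSaving.Negative.FreeBoxPowerSavingProfile
import Summits.CriticalPhenomena.PercolationContinuityZ3.Theorems.FreeBoxSparse.Negative.DCTFloor

/-!
# Crux `FreeBoxPowerSaving` (stmt-CriticalPhenomena-4447) — round-2 idea `subcritical-runaway-closure` (ideator 5)

Sketch file.  The RUNAWAY CLOSURE (Hutchcroft, arXiv:2103.17013 Prop. 2.7 / Lemma 2.8, transplanted
from the hierarchical lattice to the free box of `ℤ³`): the absurdity is `χ(p) < ∞` for `p < p_c`
(`pairSum_le_card_mul_chi`), so the crux follows from — and is equivalent to — the statement that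
below `p_c` a scale violating the threshold `s_p(n) ≥ C n^{3-a}` is never the LAST violating scale.

* `sps p n = S_p(n)/|B(n)|` (per-site in-box susceptibility), `thr C a n = C n^{3-a}`;
* `NoLastViolatingScale`, `UpwardPropagation` (the residual, weakest and scale-map forms);
* `freeBoxPowerSaving_of_noLastViolatingScale` — the closure lemma, PROVED from tree facts;
* `boundaryRootedSum`, `LayerGain`, `transEquatorial`, `StraddlingGain` — the nearest-neighbour
  substitutes for Hutchcroft's long-edge gluing term (statements; provable now, not proved here).
-/

namespace Summit.CriticalPhenomena.PercolationContinuityZ3.Cruxes.FreeBoxPowerSaving.RunawayClosure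

open MeasureTheory Filter
open Literature.Probability.Percolation Literature.Probability.LatticeModels
open Summit.CriticalPhenomena.PercolationContinuityZ3.Theses.PercNonProliferation
open Summit.CriticalPhenomena.PercolationContinuityZ3.FreeBoxPowerSavingNegative
open Summit.CriticalPhenomena.PercolationContinuityZ3.Theorems.FreeBoxSparse.Negative
  (freePairAverage_criticalProbI_le_of_forall_lt)
open scoped BigOperators Topology

noncomputable section

/-- Per-site in-box susceptibility `s_p(n) = S_p(n) / |B(n)| = |B(n)|⁻¹ Σ_{x∈B(n)} E_p|C_{B(n)}(x)|`. -/
def sps (p : unitInterval) (n : ℕ) : ℝ := pairSum p n / ((box 3 n).card : ℝ)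

/-- The threshold family `T_n = C · n^{3-a}` (the crux with exponent `a` is `s_{p_c}(n) ≲ T_n`). -/
def thr (C a : ℝ) (n : ℕ) : ℝ := C * (n : ℝ) ^ (3 - a)

/-- RESIDUAL, weakest form: below `p_c`, a scale `n ≥ n₀` at which `s_p(n) ≥ C n^{3-a}` is never the
last such scale. -/
def NoLastViolatingScale (a C : ℝ) (n₀ : ℕ) : Prop :=
  ∀ p : unitInterval, (p : ℝ) < criticalProb (zdGraph 3) (0 : Site 3) → ∀ n : ℕ, n₀ ≤ n →
    thr C a n ≤ sps p n → ∃ m : ℕ, n < m ∧ thr C a m ≤ sps p m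

/-- RESIDUAL, scale-map form (UPWARD PROPAGATION along `N`, e.g. `N n = 3n+1` or `N n = n^κ`):
above-threshold mass at scale `n` forces above-threshold mass at scale `N n`, at the SAME `p < p_c`. -/
def UpwardPropagation (a C : ℝ) (n₀ : ℕ) (N : ℕ → ℕ) : Prop :=
  ∀ p : unitInterval, (p : ℝ) < criticalProb (zdGraph 3) (0 : Site 3) → ∀ n : ℕ, n₀ ≤ n →
    thr C a n ≤ sps p n → thr C a (N n) ≤ sps p (N n)

theorem noLastViolatingScale_of_upwardPropagation {a C : ℝ} {n₀ : ℕ} {N : ℕ → ℕ}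
    (hN : ∀ n, n < N n) (h : UpwardPropagation a C n₀ N) : NoLastViolatingScale a C n₀ :=
  fun p hp n hn hv => ⟨N n, hN n, h p hp n hn hv⟩

/-- Below `p_c`, `s_p(n) ≤ χ(p) = Σ_z τ_p(0,z)` for every `n` (the ABSURDITY used by the closure). -/
theorem sps_le_chi (p : unitInterval) (hp : (p : ℝ) < criticalProb (zdGraph 3) (0 : Site 3)) (n : ℕ) :
    sps p n ≤ ∑' z : Site 3, tau 3 p 0 z := by
  unfold sps
  rw [div_le_iff₀ (card_box_pos n), mul_comm]
  exact pairSum_le_card_mul_chi p hp n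

/-- `FA₂ = s / |B|`. -/
theorem fa2_eq_sps_div (p : unitInterval) (n : ℕ) : fa2 p n = sps p n / ((box 3 n).card : ℝ) := by
  unfold fa2 sps
  rw [div_div, sq]

/-- **CLOSURE LEMMA (Hutchcroft's runaway argument on the free box of `ℤ³`).**  If below `p_c` no
violating scale is ever the last one, then `FreeBoxPowerSaving` holds (with the same exponent `a`).
Proof: for `p < p_c` every violating scale `m` has `C m^{3-a} ≤ s_p(m) ≤ χ(p)`, so violating scales
are bounded; a bounded nonempty set of naturals closed under "there is a larger element" is absurd;
hence `s_p(n) < C n^{3-a}` for all `n ≥ n₀` and all `p < p_c`, i.e. `FA₂(p,n) ≤ C n^{-a}`; pass to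
`p_c` by left-continuity of the cylinder polynomial and absorb `n < n₀` into the constant. -/
theorem freeBoxPowerSaving_of_noLastViolatingScale {a C : ℝ} (ha : 0 < a) (ha3 : a < 3)
    (hC : 0 < C) {n₀ : ℕ} (hn₀ : 1 ≤ n₀) (h : NoLastViolatingScale a C n₀) :
    FreeBoxPowerSaving := by
  -- Step 1: below `p_c` no scale `n ≥ n₀` violates the threshold.
  have hsub : ∀ p : unitInterval, (p : ℝ) < criticalProb (zdGraph 3) (0 : Site 3) →
      ∀ n : ℕ, n₀ ≤ n → sps p n < thr C a n := by
    intro p hp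
    set χ : ℝ := ∑' z : Site 3, tau 3 p 0 z with hχdef
    have h3a : 0 < 3 - a := by linarith
    -- every violating scale is at most `M`
    obtain ⟨M, hM⟩ : ∃ M : ℕ, ∀ m : ℕ, thr C a m ≤ sps p m → m ≤ M := by
      refine ⟨⌈(χ / C) ^ (1 / (3 - a))⌉₊, fun m hm => ?_⟩
      have h1 : C * (m : ℝ) ^ (3 - a) ≤ χ := hm.trans (sps_le_chi p hp m)
      have h2 : (m : ℝ) ^ (3 - a) ≤ χ / C := by
        rw [le_div_iff₀ hC, mul_comm]; exact h1
      have hm0 : (0 : ℝ) ≤ m := Nat.cast_nonneg m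
      have h3 : (m : ℝ) ≤ (χ / C) ^ (1 / (3 - a)) := by
        have := Real.rpow_le_rpow (Real.rpow_nonneg hm0 _) h2 (le_of_lt (one_div_pos.2 h3a))
        rwa [← Real.rpow_mul hm0, mul_one_div_cancel h3a.ne', Real.rpow_one] at this
      exact_mod_cast h3.trans (Nat.le_ceil _)
    -- descent on `M + 1 - m`
    have key : ∀ k : ℕ, ∀ m : ℕ, M + 1 - m = k → n₀ ≤ m → thr C a m ≤ sps p m → False := by
      intro k
      induction k using Nat.strong_induction_on with
      | _ k ih =>
        intro m hk hm hv
        have hmM : m ≤ M := hM m hv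
        obtain ⟨m', hmm', hv'⟩ := h p hp m hm hv
        have hM' : m' ≤ M := hM m' hv'
        have hlt : M + 1 - m' < k := by omega
        exact ih _ hlt m' rfl (le_trans hm hmm'.le) hv'
    intro n hn
    by_contra hcon
    exact key _ n rfl hn (not_lt.1 hcon)
  -- Step 2: hence `FA₂(p,n) ≤ C n^{-a}` for `p < p_c`, `n ≥ n₀`.
  have hfa2 : ∀ p : unitInterval, (p : ℝ) < criticalProb (zdGraph 3) (0 : Site 3) →
      ∀ n : ℕ, n₀ ≤ n → fa2 p n ≤ C * (n : ℝ) ^ (-a) := by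
    intro p hp n hn
    have hn1 : 1 ≤ n := hn₀.trans hn
    have hnpos : (0 : ℝ) < n := by exact_mod_cast hn1
    have hlt := hsub p hp n hn
    rw [fa2_eq_sps_div, div_le_iff₀ (card_box_pos n)]
    have hcard : (n : ℝ) ^ (3 : ℝ) ≤ ((box 3 n).card : ℝ) := by
      rw [card_box_real, show (3 : ℝ) = ((3 : ℕ) : ℝ) by norm_num, Real.rpow_natCast]
      have : (n : ℝ) ≤ 2 * n + 1 := by linarith
      gcongr
    have hsplit : (n : ℝ) ^ (3 - a) = (n : ℝ) ^ (-a) * (n : ℝ) ^ (3 : ℝ) := by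
      rw [← Real.rpow_add hnpos]; congr 1; ring
    have hna : 0 ≤ (n : ℝ) ^ (-a) := Real.rpow_nonneg hnpos.le _
    calc sps p n ≤ thr C a n := hlt.le
      _ = C * ((n : ℝ) ^ (-a) * (n : ℝ) ^ (3 : ℝ)) := by rw [thr, hsplit]
      _ ≤ C * ((n : ℝ) ^ (-a) * ((box 3 n).card : ℝ)) :=
          mul_le_mul_of_nonneg_left (mul_le_mul_of_nonneg_left hcard hna) hC.le
      _ = C * (n : ℝ) ^ (-a) * ((box 3 n).card : ℝ) := by ring
  -- Step 3: left-continuity transfer to `p_c`.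
  have hpc : ∀ n : ℕ, n₀ ≤ n → fa2 (criticalProbI 3) n ≤ C * (n : ℝ) ^ (-a) := by
    intro n hn
    have := freePairAverage_criticalProbI_le_of_forall_lt n (c := C * (n : ℝ) ^ (-a))
      (fun p hp => by
        have h' := hfa2 p hp n hn
        unfold fa2 pairSum at h'
        exact h')
    unfold fa2 pairSum
    exact this
  -- Step 4: absorb small `n`.
  rw [freeBoxPowerSaving_iff_fa2]
  obtain ⟨C', hC'⟩ := of_eventually (p := criticalProbI 3) ha
    (eventually_atTop.2 ⟨n₀, fun n hn => hpc n hn⟩)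
  exact ⟨a, C', ha, hC'⟩

/-- The usable corollary: UPWARD PROPAGATION along any strictly increasing scale map closes the crux. -/
theorem freeBoxPowerSaving_of_upwardPropagation {a C : ℝ} (ha : 0 < a) (ha3 : a < 3)
    (hC : 0 < C) {n₀ : ℕ} (hn₀ : 1 ≤ n₀) {N : ℕ → ℕ} (hN : ∀ n, n < N n)
    (h : UpwardPropagation a C n₀ N) : FreeBoxPowerSaving :=
  freeBoxPowerSaving_of_noLastViolatingScale ha ha3 hC hn₀ (noLastViolatingScale_of_upwardPropagation hN h)

/-! ## The nearest-neighbour substitutes for the long-edge gluing term (statements only) -/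

/-- `W_∂(p,n) = Σ_{x∈B(n)} Σ_{y∈∂ⁱⁿB(n)} P_p(x ↔ y in B(n)) = E_p Σ_{pieces P} |P| · feet(P)`
(boundary-rooted in-box mass). -/
def boundaryRootedSum (p : unitInterval) (n : ℕ) : ℝ :=
  ∑ x ∈ box 3 n, ∑ y ∈ innerBoundary (zdGraph 3) (box 3 n),
    (bondPercolation (zdGraph 3) p).real (openConnIn (↑(box 3 n) : Set (Site 3)) x y)

/-- LAYER GAIN (provable now, every `p`, `n`): growing the free box by one shell raises the pair sum by
at least `2p · W_∂` — each foot `y` of a piece `P` has a private outward neighbour `φ(y)`, joined to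
`P` inside `B(n+1)` as soon as the single fresh edge `{y, φ(y)}` (independent of `B(n)`) is open.
The nearest-neighbour analogue of Hutchcroft's Lemma 2.8 cross term, with FEET in place of volume. -/
def LayerGain : Prop :=
  ∀ (p : unitInterval) (n : ℕ),
    pairSum p n + 2 * (p : ℝ) * boundaryRootedSum p n ≤ pairSum p (n + 1)

/-- `X(p,n)` = trans-equatorial pair connectivity of the free box: pairs `(x,y)` with `x₀ ≤ -1`,
`y₀ ≥ 0`, joined inside `B(n)`. -/
def transEquatorial (p : unitInterval) (n : ℕ) : ℝ :=
  ∑ x ∈ (box 3 n).filter (fun x => x 0 ≤ -1), ∑ y ∈ (box 3 n).filter (fun y => 0 ≤ y 0),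
    (bondPercolation (zdGraph 3) p).real (openConnIn (↑(box 3 n) : Set (Site 3)) x y)

/-- STRADDLING GAIN (provable now, every `p`, `n`): `S_p(3n+1) ≥ 27 S_p(n) + 108 X_p(n)` — the 27
sub-box translates of `B(n)` tile `B(3n+1)` (landed superadditivity) and each of the 54 internal
interfaces is straddled by a translate of `B(n)` whose trans-equatorial pairs are cross pairs of the
big box, disjointly over interfaces. -/
def StraddlingGain : Prop :=
  ∀ (p : unitInterval) (n : ℕ),
    27 * pairSum p n + 108 * transEquatorial p n ≤ pairSum p (3 * n + 1)

/-- The residual in its intended instance: propagation per tripling (merging efficiency above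
threshold `≥ (3^{3-a} - 1)/26`). -/
abbrev TopScaleGrowth (a C : ℝ) (n₀ : ℕ) : Prop := UpwardPropagation a C n₀ fun n => 3 * n + 1

theorem freeBoxPowerSaving_of_topScaleGrowth {a C : ℝ} (ha : 0 < a) (ha3 : a < 3) (hC : 0 < C)
    {n₀ : ℕ} (hn₀ : 1 ≤ n₀) (h : TopScaleGrowth a C n₀) : FreeBoxPowerSaving :=
  freeBoxPowerSaving_of_upwardPropagation ha ha3 hC hn₀ (fun n => by omega) h

end

end Summit.CriticalPhenomena.PercolationContinuityZ3.Cruxes.FreeBoxPowerSaving.RunawayClosure
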